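import Summits.QuantumFields.YangMills.Theorems.UnitScaleTiltProp7LocalDivergenceComparison
import HarnessLib

/-!
# Route `UnitScaleTilt`, crux K1 «MinimiserStabilityRegPr» (stmt-QuantumFields-19200), EX row `hGF` (curved member) — small members, exit (α)(b)
# «member ↦ nearest toron»: **THE TWO-BACKGROUND EDITION OF THE (L5b) DIVERGENCE COMPARISON ROW** — `|‖D*_{U₀}X̃‖² − ‖D*_W(Ad_σX)~‖²| ≤ θ‖D*_{U₀}X̃‖² +
# (1 + θ⁻¹)·12·(η⁻¹δ)²·‖X̃‖²` whenever `‖U₀^σ(b) − W(b)‖ ≤ δ` on `supp X`, for an ARBITRARY second background `W` (✓`Prop7LocalDivergenceComparison` is the case `W = 1`)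

Cell `ym3-torus` (HUMAN RULING D-0037: YM₃ on T³ is ladder rung R3 — NOT d = 4, NOT infinite volume, NOT a mass gap, NOT Clay).  Width seat `ym-ust-19200-w5` (gen 14);
offered 2026-08-30 03:17Z as the `D*` third of the (α)(b) comparison rows (★★OWNER WORDS 79∕82: small-member exit (α)(a) + (α)(b); px10 g10 `LOCATE-SMALL-MEMBERS` §(iv)).
THEOREMS ONLY (0 `def`, 0 `sorry`); `--supports stmt-QuantumFields-19200 --as helper`, count-neutral.  HONEST LABEL: a supplier row; nothing of the twisted coercivity (α)(a),
the toron gauge (P3), `hT`, `hGF`, (3.49), EX or the crux is proved here.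

THE MATHEMATICS ([Balaban1985BackgroundPropagators] (3.8) p. 392 and the covariance remark p. 393).  For two backgrounds `V, W` and a vector field `X`, every bond is met once in
`(D*_VX − D*_WX)(x) = η⁻¹Σ_μ (V(b_μ)*X(b_μ)V(b_μ) − W(b_μ)*X(b_μ)W(b_μ))`, `b_μ = ⟨x − e_μ, μ⟩`, and `V*XV − W*XW = V*·X(V − W) + (V − W)*·X·W` gives
`‖V*XV − W*XW‖_F ≤ 2‖V − W‖·‖X‖_F` (both factors unitary); hence `‖(D*_V − D*_W)X̃‖² ≤ 12·η⁻²·δ²·‖X̃‖²` as soon as `‖V(b) − W(b)‖ ≤ δ` where `X(b) ≠ 0`.  With the exact covariance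
`‖D*_{U₀^σ}(Ad_σX)~‖ = ‖D*_{U₀}X̃‖` (✓`norm_DstarL2_gaugeAct_conj_eq`) and the squares row this is the displayed inequality.  WHY THE GENERALITY MATTERS (the η-count): the error is
`(η⁻¹δ)²`, so the row is K-uniform exactly when the gauge `σ` brings `U₀` within `δ ≲ C·η` of `W` BONDWISE; at a small member (`2L^{m+n} < 2R′` coarse sites, no cube partition) the
natural `W` is a TORON (constant abelian background, `W ∈ RegPr` for every `ε₀`), not `1` — and the toron gauge must therefore be η-relative on EVERY bond, wrap bonds included.

WHAT IS PROVED (ns `…Theorems.Prop7TwoBackgroundDivergenceComparison`): §1 ★`sum_normSq_conj_sub_conj_le` (`Σ|(V*XV − W*XW)_{jk}|² ≤ 4‖V − W‖²Σ|X_{jk}|²`, `V W ∈ SU(2)`);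
§2 `divB_sub_divB_apply` (the two-background difference stencil); §3 ★★`normSq_DstarL2_sub_DstarL2_le` (first-order closeness of `D*_V` to `D*_W` on the support);
§4 ★★★`abs_normSq_DstarL2_sub_normSq_DstarL2_conj_le` (the two-background (L5b) row) and its support-free corollary `…_conj_le_of_forall`.
HONEST SCOPE.  Stencil algebra and Frobenius∕operator-norm bookkeeping; the closeness `hVW` is a HYPOTHESIS (its inhabitant at a small member is the η-relative toron gauge of P3).

References: T. Bałaban, CMP **99** (1985) 389–434 [Balaban1985BackgroundPropagators] ((3.8) p.392, (3.11) p.392, p.393); CMP **98** (1985) 17–51 [Balaban1985Averaging]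
((18)–(20) p.21); CMP **99** (1985) 75–102 [Balaban1985RegularSpaces] (Lemma 1 (1.25) p.79 — the source of η-relative smallness in an axial gauge).
-/

set_option autoImplicit false

noncomputable section

open scoped Matrix.Norms.L2Operator BigOperators Matrix

namespace Summit.QuantumFields.YangMills.Theorems.Prop7TwoBackgroundDivergenceComparison

open Literature.MathematicalPhysics.QuantumFieldTheory.Balaban1983to89
open Literature.MathematicalPhysics.QuantumFieldTheory.Balaban1983to89.T3ContinuumYM3Torus
open T3SectALandauChart (eta eta_pos)
open B10Eq27TorusAxialLog (unitsField toUField)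
open B9Eq39Adjoint (divB)
open B9TorusCalculus (torusT)
open Summit.QuantumFields.YangMills.Theorems.Prop7SectET3HilbertLetters (W₂ toL2 toL2S DstarL2)
open Summit.QuantumFields.YangMills.Theorems.Prop7DivSliceOfMemberDivSq (DstarL2_toL2_eq_toL2S)
open Summit.QuantumFields.YangMills.Theorems.Prop7PointLandauDivergence (divB_apply)
open Summit.QuantumFields.YangMills.Theorems.Prop7LaplaceAFlatLetters (norm_sq_toL2 norm_sq_toL2S)
open Summit.QuantumFields.YangMills.Theorems.Prop7LocalDivergenceComparison (abs_sq_norm_sub_sq_norm_le sum_normSq_mul_le_opNorm_sq_mul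
  sum_normSq_mul_le_mul_opNorm_sq sum_normSq_add_le sum_normSq_sum_le norm_toL2_conj_eq norm_DstarL2_gaugeAct_conj_eq)

/-! ## §1 The Frobenius row for two unitaries -/

/-- ★ **`Σ_{jk}|(V*XV − W*XW)_{jk}|² ≤ 4‖V − W‖²·Σ_{jk}|X_{jk}|²`** for `V W ∈ SU(2)`: `V*XV − W*XW = V*·(X(V − W)) + ((V − W)*X)·W`, `‖V*‖ ≤ 1`, `‖W‖ ≤ 1`,
`‖(V − W)*‖ = ‖V − W‖` (the case `W = 1` is ✓`Prop7LocalDivergenceComparison.sum_normSq_star_mul_mul_sub_le`). [cite: Balaban1985Averaging, (18)–(20) p.21] -/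
theorem sum_normSq_conj_sub_conj_le (V W : Matrix.specialUnitaryGroup (Fin 2) ℂ) (X : Matrix (Fin 2) (Fin 2) ℂ) :
    ∑ j, ∑ k, ‖(star (V : Matrix (Fin 2) (Fin 2) ℂ) * X * (V : Matrix (Fin 2) (Fin 2) ℂ)
        - star (W : Matrix (Fin 2) (Fin 2) ℂ) * X * (W : Matrix (Fin 2) (Fin 2) ℂ)) j k‖ ^ 2
      ≤ 4 * ‖(V : Matrix (Fin 2) (Fin 2) ℂ) - (W : Matrix (Fin 2) (Fin 2) ℂ)‖ ^ 2 * ∑ j, ∑ k, ‖X j k‖ ^ 2 := by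
  set v : Matrix (Fin 2) (Fin 2) ℂ := (V : Matrix (Fin 2) (Fin 2) ℂ) with hv
  set w : Matrix (Fin 2) (Fin 2) ℂ := (W : Matrix (Fin 2) (Fin 2) ℂ) with hw
  have hid : star v * X * v - star w * X * w = star v * (X * (v - w)) + (star (v - w) * X) * w := by
    rw [star_sub]; noncomm_ring
  have hstar : ‖star v‖ ≤ 1 := by
    rw [Matrix.star_eq_conjTranspose, Matrix.l2_opNorm_conjTranspose]
    exact (CStarRing.norm_coe_unitary ⟨v, Matrix.specialUnitaryGroup_le_unitaryGroup V.2⟩).le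
  have hwle : ‖w‖ ≤ 1 := (CStarRing.norm_coe_unitary ⟨w, Matrix.specialUnitaryGroup_le_unitaryGroup W.2⟩).le
  have hsd : ‖star (v - w)‖ = ‖v - w‖ := by
    rw [Matrix.star_eq_conjTranspose, Matrix.l2_opNorm_conjTranspose]
  have hX : 0 ≤ ∑ j, ∑ k, ‖X j k‖ ^ 2 := Finset.sum_nonneg fun j _ => Finset.sum_nonneg fun k _ => sq_nonneg _
  have h1 : ∑ j, ∑ k, ‖(star v * (X * (v - w))) j k‖ ^ 2 ≤ ‖v - w‖ ^ 2 * ∑ j, ∑ k, ‖X j k‖ ^ 2 := by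
    calc ∑ j, ∑ k, ‖(star v * (X * (v - w))) j k‖ ^ 2
          ≤ ‖star v‖ ^ 2 * ∑ j, ∑ k, ‖(X * (v - w)) j k‖ ^ 2 := sum_normSq_mul_le_opNorm_sq_mul _ _
      _ ≤ 1 * ∑ j, ∑ k, ‖(X * (v - w)) j k‖ ^ 2 := by
          refine mul_le_mul_of_nonneg_right ?_ (Finset.sum_nonneg fun j _ => Finset.sum_nonneg fun k _ => sq_nonneg _)
          calc ‖star v‖ ^ 2 ≤ 1 ^ 2 := pow_le_pow_left₀ (norm_nonneg _) hstar 2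
            _ = 1 := one_pow 2
      _ ≤ ‖v - w‖ ^ 2 * ∑ j, ∑ k, ‖X j k‖ ^ 2 := by rw [one_mul]; exact sum_normSq_mul_le_mul_opNorm_sq _ _
  have h2 : ∑ j, ∑ k, ‖((star (v - w) * X) * w) j k‖ ^ 2 ≤ ‖v - w‖ ^ 2 * ∑ j, ∑ k, ‖X j k‖ ^ 2 := by
    calc ∑ j, ∑ k, ‖((star (v - w) * X) * w) j k‖ ^ 2
          ≤ ‖w‖ ^ 2 * ∑ j, ∑ k, ‖(star (v - w) * X) j k‖ ^ 2 := sum_normSq_mul_le_mul_opNorm_sq _ _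
      _ ≤ 1 * ∑ j, ∑ k, ‖(star (v - w) * X) j k‖ ^ 2 := by
          refine mul_le_mul_of_nonneg_right ?_ (Finset.sum_nonneg fun j _ => Finset.sum_nonneg fun k _ => sq_nonneg _)
          calc ‖w‖ ^ 2 ≤ 1 ^ 2 := pow_le_pow_left₀ (norm_nonneg _) hwle 2
            _ = 1 := one_pow 2
      _ ≤ ‖star (v - w)‖ ^ 2 * ∑ j, ∑ k, ‖X j k‖ ^ 2 := by rw [one_mul]; exact sum_normSq_mul_le_opNorm_sq_mul _ _
      _ = ‖v - w‖ ^ 2 * ∑ j, ∑ k, ‖X j k‖ ^ 2 := by rw [hsd]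
  calc ∑ j, ∑ k, ‖(star v * X * v - star w * X * w) j k‖ ^ 2
        = ∑ j, ∑ k, ‖(star v * (X * (v - w)) + (star (v - w) * X) * w) j k‖ ^ 2 := by rw [hid]
    _ ≤ 2 * ∑ j, ∑ k, ‖(star v * (X * (v - w))) j k‖ ^ 2 + 2 * ∑ j, ∑ k, ‖((star (v - w) * X) * w) j k‖ ^ 2 := sum_normSq_add_le _ _
    _ ≤ 2 * (‖v - w‖ ^ 2 * ∑ j, ∑ k, ‖X j k‖ ^ 2) + 2 * (‖v - w‖ ^ 2 * ∑ j, ∑ k, ‖X j k‖ ^ 2) := by gcongr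
    _ = 4 * ‖v - w‖ ^ 2 * ∑ j, ∑ k, ‖X j k‖ ^ 2 := by ring

/-! ## §2 The two-background difference stencil -/

section Closeness

variable (F : T3Family) (n K : ℕ) (c₀ : ℝ) [Fact (0 < c₀)]

/-- **THE DIFFERENCE STENCIL FOR TWO BACKGROUNDS**: `(divB_V X − divB_W X)(x) = Σ_μ (V(b_μ)*X(b_μ)V(b_μ) − W(b_μ)*X(b_μ)W(b_μ))`, `b_μ = ⟨x − e_μ, μ⟩` — the untransported
letters `X(x, μ)` cancel; each bond is met once, at its target. [cite: Balaban1985BackgroundPropagators, (3.8) p.392] -/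
theorem divB_sub_divB_apply (V W : GaugeField (F.P K) 0 (Matrix.specialUnitaryGroup (Fin 2) ℂ)) (X : PBond (F.P K) 0 → Matrix (Fin 2) (Fin 2) ℂ)
    (x : Site (F.P K) 0) :
    divB (torusT (F.P K) 0) (fun κ z => unitsField (toUField V) ⟨z, κ⟩) (fun κ z => X ⟨z, κ⟩) x
        - divB (torusT (F.P K) 0) (fun κ z => unitsField (toUField W) ⟨z, κ⟩) (fun κ z => X ⟨z, κ⟩) x
      = ∑ μ : Fin (F.P K).d, (star (V ⟨x.unshift μ, μ⟩ : Matrix (Fin 2) (Fin 2) ℂ) * X ⟨x.unshift μ, μ⟩ * (V ⟨x.unshift μ, μ⟩ : Matrix (Fin 2) (Fin 2) ℂ)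
          - star (W ⟨x.unshift μ, μ⟩ : Matrix (Fin 2) (Fin 2) ℂ) * X ⟨x.unshift μ, μ⟩ * (W ⟨x.unshift μ, μ⟩ : Matrix (Fin 2) (Fin 2) ℂ)) := by
  rw [divB_apply, divB_apply, ← Finset.sum_sub_distrib]
  refine Finset.sum_congr rfl fun μ _ => ?_
  abel

/-! ## §3 ★★ First-order closeness of `D*_V` to `D*_W` on the support -/

/-- ★★ **FIRST-ORDER CLOSENESS OF `D*_V` TO `D*_W` ON THE SUPPORT**: if `‖V(b) − W(b)‖ ≤ δ` on every bond where `X(b) ≠ 0`, then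
`‖D*_VX̃ − D*_WX̃‖² ≤ 12·η⁻²·δ²·‖X̃‖²` (`η = L^{−(K−n)}`; `12 = d·4`, `d = 3`).  No hypothesis off the support of `X`; no hypothesis on `W` (any background — at the use, a toron).
The error is `(η⁻¹δ)²`: K-uniform iff `δ ≲ C·η` (the η-count). [cite: Balaban1985BackgroundPropagators, (3.8) p.392; Balaban1985RegularSpaces, Lemma 1 (1.25) p.79] -/
theorem normSq_DstarL2_sub_DstarL2_le (V W : GaugeField (F.P K) 0 (Matrix.specialUnitaryGroup (Fin 2) ℂ)) (X : PBond (F.P K) 0 → Matrix (Fin 2) (Fin 2) ℂ)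
    {δ : ℝ} (hVW : ∀ b : PBond (F.P K) 0, X b ≠ 0 → ‖(V b : Matrix (Fin 2) (Fin 2) ℂ) - (W b : Matrix (Fin 2) (Fin 2) ℂ)‖ ≤ δ) :
    ‖DstarL2 F n K c₀ V (toL2 F K c₀ X) - DstarL2 F n K c₀ W (toL2 F K c₀ X)‖ ^ 2 ≤ 12 * ((eta F n K)⁻¹) ^ 2 * δ ^ 2 * ‖toL2 F K c₀ X‖ ^ 2 := by
  have hc : 0 < c₀ := Fact.out
  have hη : 0 < eta F n K := eta_pos F n K
  -- the difference as one site function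
  set Dd : Site (F.P K) 0 → Matrix (Fin 2) (Fin 2) ℂ := fun x =>
    ∑ μ : Fin (F.P K).d, (star (V ⟨x.unshift μ, μ⟩ : Matrix (Fin 2) (Fin 2) ℂ) * X ⟨x.unshift μ, μ⟩ * (V ⟨x.unshift μ, μ⟩ : Matrix (Fin 2) (Fin 2) ℂ)
      - star (W ⟨x.unshift μ, μ⟩ : Matrix (Fin 2) (Fin 2) ℂ) * X ⟨x.unshift μ, μ⟩ * (W ⟨x.unshift μ, μ⟩ : Matrix (Fin 2) (Fin 2) ℂ)) with hDd
  have hdiff : DstarL2 F n K c₀ V (toL2 F K c₀ X) - DstarL2 F n K c₀ W (toL2 F K c₀ X) = toL2S F K c₀ (fun x => (eta F n K)⁻¹ • Dd x) := by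
    rw [DstarL2_toL2_eq_toL2S, DstarL2_toL2_eq_toL2S, ← map_sub]
    congr 1
    funext x
    rw [Pi.sub_apply, ← smul_sub, divB_sub_divB_apply]
  -- bondwise bound `Σ|V*XV − W*XW|² ≤ 4δ²Σ|X|²` (trivial where `X = 0`)
  have hbond : ∀ b : PBond (F.P K) 0,
      ∑ j, ∑ k, ‖(star (V b : Matrix (Fin 2) (Fin 2) ℂ) * X b * (V b : Matrix (Fin 2) (Fin 2) ℂ)
          - star (W b : Matrix (Fin 2) (Fin 2) ℂ) * X b * (W b : Matrix (Fin 2) (Fin 2) ℂ)) j k‖ ^ 2 ≤ 4 * δ ^ 2 * ∑ j, ∑ k, ‖X b j k‖ ^ 2 := by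
    intro b
    by_cases hX : X b = 0
    · simp [hX]
    · calc _ ≤ 4 * ‖(V b : Matrix (Fin 2) (Fin 2) ℂ) - (W b : Matrix (Fin 2) (Fin 2) ℂ)‖ ^ 2 * ∑ j, ∑ k, ‖X b j k‖ ^ 2 :=
            sum_normSq_conj_sub_conj_le (V b) (W b) (X b)
        _ ≤ 4 * δ ^ 2 * ∑ j, ∑ k, ‖X b j k‖ ^ 2 := by
            have h1 : ‖(V b : Matrix (Fin 2) (Fin 2) ℂ) - (W b : Matrix (Fin 2) (Fin 2) ℂ)‖ ^ 2 ≤ δ ^ 2 := pow_le_pow_left₀ (norm_nonneg _) (hVW b hX) 2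
            have h2 : 0 ≤ ∑ j, ∑ k, ‖X b j k‖ ^ 2 := Finset.sum_nonneg fun j _ => Finset.sum_nonneg fun k _ => sq_nonneg _
            nlinarith
  -- sitewise bound
  have hsite : ∀ x : Site (F.P K) 0, ∑ j, ∑ k, ‖Dd x j k‖ ^ 2
      ≤ 3 * ∑ μ : Fin (F.P K).d, (4 * δ ^ 2 * ∑ j, ∑ k, ‖X ⟨x.unshift μ, μ⟩ j k‖ ^ 2) := by
    intro x
    calc ∑ j, ∑ k, ‖Dd x j k‖ ^ 2
          ≤ Fintype.card (Fin (F.P K).d) * ∑ μ : Fin (F.P K).d, ∑ j, ∑ k,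
              ‖(star (V ⟨x.unshift μ, μ⟩ : Matrix (Fin 2) (Fin 2) ℂ) * X ⟨x.unshift μ, μ⟩ * (V ⟨x.unshift μ, μ⟩ : Matrix (Fin 2) (Fin 2) ℂ)
                - star (W ⟨x.unshift μ, μ⟩ : Matrix (Fin 2) (Fin 2) ℂ) * X ⟨x.unshift μ, μ⟩ * (W ⟨x.unshift μ, μ⟩ : Matrix (Fin 2) (Fin 2) ℂ)) j k‖ ^ 2 :=
            sum_normSq_sum_le _
      _ = 3 * ∑ μ : Fin (F.P K).d, ∑ j, ∑ k,
              ‖(star (V ⟨x.unshift μ, μ⟩ : Matrix (Fin 2) (Fin 2) ℂ) * X ⟨x.unshift μ, μ⟩ * (V ⟨x.unshift μ, μ⟩ : Matrix (Fin 2) (Fin 2) ℂ)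
                - star (W ⟨x.unshift μ, μ⟩ : Matrix (Fin 2) (Fin 2) ℂ) * X ⟨x.unshift μ, μ⟩ * (W ⟨x.unshift μ, μ⟩ : Matrix (Fin 2) (Fin 2) ℂ)) j k‖ ^ 2 := by
            rw [Fintype.card_fin]; norm_num
      _ ≤ 3 * ∑ μ : Fin (F.P K).d, (4 * δ ^ 2 * ∑ j, ∑ k, ‖X ⟨x.unshift μ, μ⟩ j k‖ ^ 2) := by
            gcongr with μ _
            exact hbond ⟨x.unshift μ, μ⟩
  -- sum over the sites and reindex the bonds by their target
  have hre : ∑ x : Site (F.P K) 0, ∑ μ : Fin (F.P K).d, ∑ j, ∑ k, ‖X ⟨x.unshift μ, μ⟩ j k‖ ^ 2 = ∑ b : PBond (F.P K) 0, ∑ j, ∑ k, ‖X b j k‖ ^ 2 := by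
    rw [B10StarCount.sum_pbond, Finset.sum_comm]
    conv_rhs => rw [Finset.sum_comm]
    refine Finset.sum_congr rfl fun μ _ => ?_
    exact Fintype.sum_equiv (B10StarCount.shiftEquiv μ).symm (fun z => ∑ j, ∑ k, ‖X ⟨z.unshift μ, μ⟩ j k‖ ^ 2)
      (fun z => ∑ j, ∑ k, ‖X ⟨z, μ⟩ j k‖ ^ 2) (fun _ => rfl)
  have hsum : ∑ x : Site (F.P K) 0, ∑ j, ∑ k, ‖Dd x j k‖ ^ 2 ≤ 12 * δ ^ 2 * ∑ b : PBond (F.P K) 0, ∑ j, ∑ k, ‖X b j k‖ ^ 2 := by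
    calc ∑ x : Site (F.P K) 0, ∑ j, ∑ k, ‖Dd x j k‖ ^ 2
          ≤ ∑ x : Site (F.P K) 0, 3 * ∑ μ : Fin (F.P K).d, (4 * δ ^ 2 * ∑ j, ∑ k, ‖X ⟨x.unshift μ, μ⟩ j k‖ ^ 2) := Finset.sum_le_sum fun x _ => hsite x
      _ = 12 * δ ^ 2 * ∑ x : Site (F.P K) 0, ∑ μ : Fin (F.P K).d, ∑ j, ∑ k, ‖X ⟨x.unshift μ, μ⟩ j k‖ ^ 2 := by
            rw [Finset.mul_sum]
            refine Finset.sum_congr rfl fun x _ => ?_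
            rw [Finset.mul_sum, Finset.mul_sum]
            refine Finset.sum_congr rfl fun μ _ => ?_
            ring
      _ = 12 * δ ^ 2 * ∑ b : PBond (F.P K) 0, ∑ j, ∑ k, ‖X b j k‖ ^ 2 := by rw [hre]
  -- the weighted norms
  have hsm : ∀ x : Site (F.P K) 0, ∑ j, ∑ k, ‖((eta F n K)⁻¹ • Dd x) j k‖ ^ 2 = ((eta F n K)⁻¹) ^ 2 * ∑ j, ∑ k, ‖Dd x j k‖ ^ 2 := by
    intro x
    rw [Finset.mul_sum]
    refine Finset.sum_congr rfl fun j _ => ?_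
    rw [Finset.mul_sum]
    refine Finset.sum_congr rfl fun k _ => ?_
    rw [Matrix.smul_apply, norm_smul, mul_pow, Real.norm_of_nonneg (inv_nonneg.mpr hη.le)]
  rw [hdiff, norm_sq_toL2S, norm_sq_toL2]
  simp_rw [hsm]
  rw [← Finset.mul_sum]
  have h0 : 0 ≤ ((eta F n K)⁻¹) ^ 2 := sq_nonneg _
  calc c₀ * (((eta F n K)⁻¹) ^ 2 * ∑ x : Site (F.P K) 0, ∑ j, ∑ k, ‖Dd x j k‖ ^ 2)
        ≤ c₀ * (((eta F n K)⁻¹) ^ 2 * (12 * δ ^ 2 * ∑ b : PBond (F.P K) 0, ∑ j, ∑ k, ‖X b j k‖ ^ 2)) := by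
          exact mul_le_mul_of_nonneg_left (mul_le_mul_of_nonneg_left hsum h0) hc.le
    _ = 12 * ((eta F n K)⁻¹) ^ 2 * δ ^ 2 * (c₀ * ∑ b : PBond (F.P K) 0, ∑ j, ∑ k, ‖X b j k‖ ^ 2) := by ring

/-- **SUPPORT-FREE FORM**: if `‖V(b) − W(b)‖ ≤ δ` on EVERY bond (the whole-torus toron gauge of a small member), then `‖D*_VX̃ − D*_WX̃‖ ² ≤ 12·η⁻²·δ²·‖X̃‖²` for every `X`.
[cite: Balaban1985BackgroundPropagators, (3.8) p.392] -/
theorem normSq_DstarL2_sub_DstarL2_le_of_forall (V W : GaugeField (F.P K) 0 (Matrix.specialUnitaryGroup (Fin 2) ℂ)) (X : PBond (F.P K) 0 → Matrix (Fin 2) (Fin 2) ℂ)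
    {δ : ℝ} (hVW : ∀ b : PBond (F.P K) 0, ‖(V b : Matrix (Fin 2) (Fin 2) ℂ) - (W b : Matrix (Fin 2) (Fin 2) ℂ)‖ ≤ δ) :
    ‖DstarL2 F n K c₀ V (toL2 F K c₀ X) - DstarL2 F n K c₀ W (toL2 F K c₀ X)‖ ^ 2 ≤ 12 * ((eta F n K)⁻¹) ^ 2 * δ ^ 2 * ‖toL2 F K c₀ X‖ ^ 2 :=
  normSq_DstarL2_sub_DstarL2_le F n K c₀ V W X fun b _ => hVW b

end Closeness

/-! ## §4 ★★★ The two-background (L5b) row -/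

section Row

variable (F : T3Family) (n K : ℕ) (c₀ : ℝ) [Fact (0 < c₀)]

/-- ★★★ **THE TWO-BACKGROUND (L5b) ROW — THE GAUGE COMPARISON OF THE DIVERGENCE TERM AGAINST AN ARBITRARY BACKGROUND `W`.**  For backgrounds `U₀, W`, a gauge transformation `σ`
with `‖U₀^σ(b) − W(b)‖ ≤ δ` on every bond where `X(b) ≠ 0`, and any `θ > 0`:
`|‖D*_{U₀}X̃‖² − ‖D*_W(Ad_σX)~‖²| ≤ θ·‖D*_{U₀}X̃‖² + (1 + θ⁻¹)·(12·η⁻²·δ²)·‖X̃‖²`, `(Ad_σX)(b) = σ(b₋)X(b)σ(b₋)*`.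
At `W = 1` this is ✓`Prop7LocalDivergenceComparison.abs_normSq_DstarL2_sub_normSq_DstarL2_one_conj_le`; at a small member `W` is the nearest toron and `σ` the η-relative toron gauge.
[cite: Balaban1985BackgroundPropagators, (3.8) p.392, p.393; Balaban1985RegularSpaces, Lemma 1 (1.25) p.79] -/
theorem abs_normSq_DstarL2_sub_normSq_DstarL2_conj_le (σ : GaugeTransf (F.P K) 0 (Matrix.specialUnitaryGroup (Fin 2) ℂ))
    (U₀ W : GaugeField (F.P K) 0 (Matrix.specialUnitaryGroup (Fin 2) ℂ)) (X : PBond (F.P K) 0 → Matrix (Fin 2) (Fin 2) ℂ) {δ θ : ℝ} (hθ : 0 < θ)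
    (hVW : ∀ b : PBond (F.P K) 0, X b ≠ 0 →
      ‖((GaugeField.gaugeAct σ U₀ b : Matrix.specialUnitaryGroup (Fin 2) ℂ) : Matrix (Fin 2) (Fin 2) ℂ) - (W b : Matrix (Fin 2) (Fin 2) ℂ)‖ ≤ δ) :
    |‖DstarL2 F n K c₀ U₀ (toL2 F K c₀ X)‖ ^ 2
        - ‖DstarL2 F n K c₀ W (toL2 F K c₀ (fun b => (σ b.src : Matrix (Fin 2) (Fin 2) ℂ) * X b * star (σ b.src : Matrix (Fin 2) (Fin 2) ℂ)))‖ ^ 2|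
      ≤ θ * ‖DstarL2 F n K c₀ U₀ (toL2 F K c₀ X)‖ ^ 2 + (1 + θ⁻¹) * (12 * ((eta F n K)⁻¹) ^ 2 * δ ^ 2) * ‖toL2 F K c₀ X‖ ^ 2 := by
  set Xσ : PBond (F.P K) 0 → Matrix (Fin 2) (Fin 2) ℂ := fun b => (σ b.src : Matrix (Fin 2) (Fin 2) ℂ) * X b * star (σ b.src : Matrix (Fin 2) (Fin 2) ℂ) with hXσ
  rw [← norm_DstarL2_gaugeAct_conj_eq F n K c₀ σ U₀ X]
  have hsupp : ∀ b : PBond (F.P K) 0, Xσ b ≠ 0 →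
      ‖((GaugeField.gaugeAct σ U₀ b : Matrix.specialUnitaryGroup (Fin 2) ℂ) : Matrix (Fin 2) (Fin 2) ℂ) - (W b : Matrix (Fin 2) (Fin 2) ℂ)‖ ≤ δ := by
    intro b hb
    refine hVW b fun h0 => hb ?_
    simp [hXσ, h0]
  have hclose := normSq_DstarL2_sub_DstarL2_le F n K c₀ (GaugeField.gaugeAct σ U₀) W Xσ hsupp
  rw [norm_toL2_conj_eq] at hclose
  have hsq := abs_sq_norm_sub_sq_norm_le (DstarL2 F n K c₀ (GaugeField.gaugeAct σ U₀) (toL2 F K c₀ Xσ)) (DstarL2 F n K c₀ W (toL2 F K c₀ Xσ)) hθ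
  have hθ' : 0 ≤ 1 + θ⁻¹ := by positivity
  calc _ ≤ θ * ‖DstarL2 F n K c₀ (GaugeField.gaugeAct σ U₀) (toL2 F K c₀ Xσ)‖ ^ 2
          + (1 + θ⁻¹) * ‖DstarL2 F n K c₀ (GaugeField.gaugeAct σ U₀) (toL2 F K c₀ Xσ) - DstarL2 F n K c₀ W (toL2 F K c₀ Xσ)‖ ^ 2 := hsq
    _ ≤ θ * ‖DstarL2 F n K c₀ (GaugeField.gaugeAct σ U₀) (toL2 F K c₀ Xσ)‖ ^ 2 + (1 + θ⁻¹) * (12 * ((eta F n K)⁻¹) ^ 2 * δ ^ 2 * ‖toL2 F K c₀ X‖ ^ 2) := by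
          gcongr
    _ = _ := by ring

/-- ★★ **THE TWO-BACKGROUND (L5b) ROW, SUPPORT-FREE** (the small-member shape: one gauge, every bond): if `‖U₀^σ(b) − W(b)‖ ≤ δ` for ALL bonds, the row holds for every `X`.
[cite: Balaban1985BackgroundPropagators, (3.8) p.392, p.393] -/
theorem abs_normSq_DstarL2_sub_normSq_DstarL2_conj_le_of_forall (σ : GaugeTransf (F.P K) 0 (Matrix.specialUnitaryGroup (Fin 2) ℂ))
    (U₀ W : GaugeField (F.P K) 0 (Matrix.specialUnitaryGroup (Fin 2) ℂ)) {δ θ : ℝ} (hθ : 0 < θ)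
    (hVW : ∀ b : PBond (F.P K) 0,
      ‖((GaugeField.gaugeAct σ U₀ b : Matrix.specialUnitaryGroup (Fin 2) ℂ) : Matrix (Fin 2) (Fin 2) ℂ) - (W b : Matrix (Fin 2) (Fin 2) ℂ)‖ ≤ δ)
    (X : PBond (F.P K) 0 → Matrix (Fin 2) (Fin 2) ℂ) :
    |‖DstarL2 F n K c₀ U₀ (toL2 F K c₀ X)‖ ^ 2
        - ‖DstarL2 F n K c₀ W (toL2 F K c₀ (fun b => (σ b.src : Matrix (Fin 2) (Fin 2) ℂ) * X b * star (σ b.src : Matrix (Fin 2) (Fin 2) ℂ)))‖ ^ 2|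
      ≤ θ * ‖DstarL2 F n K c₀ U₀ (toL2 F K c₀ X)‖ ^ 2 + (1 + θ⁻¹) * (12 * ((eta F n K)⁻¹) ^ 2 * δ ^ 2) * ‖toL2 F K c₀ X‖ ^ 2 :=
  abs_normSq_DstarL2_sub_normSq_DstarL2_conj_le F n K c₀ σ U₀ W X hθ fun b _ => hVW b

end Row

end Summit.QuantumFields.YangMills.Theorems.Prop7TwoBackgroundDivergenceComparison

end
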